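import Summits.CriticalPhenomena.PercolationContinuityZ3.Theorems.PercNearOneGluingNoHeavyLowerTailSahiGoodAxis
import Summits.CriticalPhenomena.PercolationContinuityZ3.Theorems.PercNearOneGluingNoHeavyLowerTailSahiCoordinateTwoThirdsFalse
import Mathlib.Tactic.Linarith
import Mathlib.Tactic.NormNum
import Mathlib.Tactic.FinCases
import HarnessLib

/-!
# `NoHeavyLowerTail` (crux stmt-CriticalPhenomena-4575): conjecture GA (`SahiGoodAxis.GoodAxis`, "one good axis") is FALSE —
# the doubled star on six coins at bias `3/5` has negative sectional chord defect along EVERY axis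

Support file (cell `prim-masterthm`, seat P2, generation 16; `--supports stmt-CriticalPhenomena-4575`).  No `sorry`, no named facts,
standard axioms; a kernel-checked finite computation.

THE CONJECTURE REFUTED.  `SahiGoodAxis.GoodAxis` (cell `prim-bnk`, bnk-2 gen 11): for every product measure `μ_q`, every triple of
increasing events and every nonempty determining set `S` of coordinates, SOME `a ∈ S` has
`q_a·Φ_a(1) + (1 − q_a)·Φ_a(0) ≤ Φ_a(q_a)` (`Φ_a` the fibre cubic `cubicE3`; "along some axis `E_3` is at least the average of its two
sectional values").  This is the chord criterion called (B∃) in the master-family line, where it was found to die at six coins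
(SAHI-ROUTE.md §4.38–4.39): its census (`n ≤ 4` exhaustive × 44 measures, `n = 5` exhaustive at `q ∈ {1/2, 1/3, 2/3, 1/5}`, annealing
`n ≤ 7`, symmetric families) missed the following instance because the bias `3/5` is off its grids and the family is invisible below
`n = 6`.

THE WITNESS (the DOUBLED STAR).  `ι = Fin 6`, three disjoint pairs `P = x₀ ∨ x₁`, `Q = x₂ ∨ x₃`, `R = x₄ ∨ x₅` (each coin of the
star-α triple `(p(q∨r), (p∨q)r, q(p∨r))` replaced by a parallel pair), events
  `A = P ∧ (Q ∨ R)`,  `B = (P ∨ Q) ∧ R`,  `C = Q ∧ (P ∨ R)`,  all biases `q ≡ 3/5`,  `S =` all six coordinates.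
With integer weights `w(ω) = 3^{|ω|}·2^{6−|ω|}` (so `μ_q(ω) = w(ω)/5⁶`): `Σ_A w = Σ_B w = Σ_C w = 12789`, pairwise `11025`, triple `9261`,
whence `E_3(μ_q) = Φ_a(q_a) = 4407346944/5¹⁸`.  Along every axis `a` the `1`-section kills one pair-letter (`P`, `Q` or `R` becomes sure)
and the sectional triple has `E_3 = 0` exactly (`Φ_a(1) = 0`), while the `0`-section has `Φ_a(0) = 93901248/5¹⁵`; hence
`q_aΦ_a(1) + (1−q_a)Φ_a(0) = (2/5)·93901248/5¹⁵ = 4695062400/5¹⁸ > 4407346944/5¹⁸ = Φ_a(q_a)` for ALL six `a`: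
the sectional defect is `−287715456/5¹⁸` on every axis (the instance is invariant under the wreath product `S₂ ≀ S₃`, which is
transitive on the six coordinates, so one axis decides all).  `not_goodAxis : ¬ GoodAxis`.

WHAT SURVIVES (this seat, `…SahiSliceMinimum`): the SLICE MINIMUM PRINCIPLE `E_3(μ_q) ≥ min_{a,b} Φ_a(b)` — here `min = Φ_a(1) = 0` — which
also implies Kahn's Conjecture 5 and is census-clean through `n = 5` exhaustive (kit j153426: 7.26·10¹⁰ triples × 6 measures).
In all doubled families the top facets vanish, which is exactly why the chord (an average) fails while the minimum does not.
HONEST FRAMING: one typed conjecture of the programme is settled in the negative; Kahn's `C_3` / `MasterFamilyNonneg 3` and the slice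
minimum principle remain OPEN.  Axioms standard. [this work]
-/

noncomputable section

open scoped Classical

namespace Summit.CriticalPhenomena.PercolationContinuityZ3.Theorems

namespace SahiGoodAxisFalse

open Finset Function Literature.Combinatorics.Sahi2008
open Literature.Probability.Percolation (DeterminedBy determinedBy_iff)
open Literature.Probability.Percolation.DecisionTree (ind ind_of_mem ind_of_not_mem)
open SahiC3Cube (pt)
open SahiGoodAxis (GoodAxis)
open SahiCoordinateTwoThirdsFalse (ind_eq_ite)

/-! ### 1. The instance -/

/-- `A = P ∧ (Q ∨ R)` with `P = x₀ ∨ x₁`, `Q = x₂ ∨ x₃`, `R = x₄ ∨ x₅`. [this work] -/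
def dsA : Set (Set (Fin 6)) :=
  {ω | ((0 : Fin 6) ∈ ω ∨ (1 : Fin 6) ∈ ω) ∧ (((2 : Fin 6) ∈ ω ∨ (3 : Fin 6) ∈ ω) ∨ ((4 : Fin 6) ∈ ω ∨ (5 : Fin 6) ∈ ω))}

/-- `B = (P ∨ Q) ∧ R`. [this work] -/
def dsB : Set (Set (Fin 6)) :=
  {ω | (((0 : Fin 6) ∈ ω ∨ (1 : Fin 6) ∈ ω) ∨ ((2 : Fin 6) ∈ ω ∨ (3 : Fin 6) ∈ ω)) ∧ ((4 : Fin 6) ∈ ω ∨ (5 : Fin 6) ∈ ω)}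

/-- `C = Q ∧ (P ∨ R)`. [this work] -/
def dsC : Set (Set (Fin 6)) :=
  {ω | ((2 : Fin 6) ∈ ω ∨ (3 : Fin 6) ∈ ω) ∧ (((0 : Fin 6) ∈ ω ∨ (1 : Fin 6) ∈ ω) ∨ ((4 : Fin 6) ∈ ω ∨ (5 : Fin 6) ∈ ω))}

/-- The triple `U = (A, B, C)` (the doubled star). [this work] -/
def dsU : Fin 3 → Set (Set (Fin 6)) := ![dsA, dsB, dsC]

/-- The bias `3/5` as a point of the unit interval. [this work] -/
def threeFifths : unitInterval := ⟨3 / 5, by norm_num, by norm_num⟩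

/-- The constant parameter vector `q ≡ 3/5`. [this work] -/
def q35 : Fin 6 → unitInterval := fun _ => threeFifths

/-- `(q a : ℝ) = 3/5`. [this work] -/
theorem coe_q35 (a : Fin 6) : ((q35 a : unitInterval) : ℝ) = 3 / 5 := rfl

/-- An `∨`-of-coordinates clause is monotone. [folklore] -/
theorem or_mono {ω ω' : Set (Fin 6)} (hle : ω ≤ ω') {i j : Fin 6} (h : i ∈ ω ∨ j ∈ ω) : i ∈ ω' ∨ j ∈ ω' :=
  h.imp (fun hi => hle hi) (fun hj => hle hj)

/-- `A` is an up-set. [this work] -/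
theorem isUpperSet_dsA : IsUpperSet dsA := by
  intro ω ω' hle hω
  exact ⟨or_mono hle hω.1, hω.2.imp (or_mono hle) (or_mono hle)⟩

/-- `B` is an up-set. [this work] -/
theorem isUpperSet_dsB : IsUpperSet dsB := by
  intro ω ω' hle hω
  exact ⟨hω.1.imp (or_mono hle) (or_mono hle), or_mono hle hω.2⟩

/-- `C` is an up-set. [this work] -/
theorem isUpperSet_dsC : IsUpperSet dsC := by
  intro ω ω' hle hω
  exact ⟨or_mono hle hω.1, hω.2.imp (or_mono hle) (or_mono hle)⟩

/-- All three events are up-sets. [this work] -/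
theorem isUpperSet_dsU : ∀ j, IsUpperSet (dsU j) := by
  intro j; fin_cases j
  · exact isUpperSet_dsA
  · exact isUpperSet_dsB
  · exact isUpperSet_dsC

/-- Every event is determined by the full coordinate set. [folklore] -/
theorem determinedBy_univ' (X : Set (Set (Fin 6))) : DeterminedBy X (↑(Finset.univ : Finset (Fin 6)) : Set (Fin 6)) := by
  rw [determinedBy_iff]
  intro ω ω' h
  simp only [Finset.coe_univ, Set.inter_univ] at h
  rw [h]

/-! ### 2. Integer weights and the three kinds of expectation as sums over the 64 codes -/

/-- The weight letter of bit `i` of the code `j`: `3` if set, `2` if not (numerators of `3/5`, `2/5`). [this work] -/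
def bw (j : ℕ) (i : Fin 6) : ℕ := if j.testBit i = true then 3 else 2

/-- `w(j) = ∏_i bw(j,i) = 3^{|ω|}2^{6−|ω|}`: `5⁶·μ_q(pt 6 j)`. [this work] -/
def wt (j : ℕ) : ℕ := ∏ i : Fin 6, bw j i

/-- The weight off the coordinate `a`: `∏_{i ≠ a} bw(j,i)` (`5⁵ ×` the conditional weights; `a` as a natural number so
that the kernel computations below are stated uniformly in `a`). [this work] -/
def wtE (a : ℕ) (j : ℕ) : ℕ := ∏ i : Fin 6, if (i : ℕ) = a then 1 else bw j i

/-- `wtE a j` is the product of the weight letters over the coordinates other than `a`. [this work] -/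
theorem wtE_eq (a : Fin 6) (j : ℕ) : (wtE a j : ℝ) = ∏ i ∈ Finset.univ.erase a, (bw j i : ℝ) := by
  rw [wtE, ← Finset.mul_prod_erase Finset.univ _ (Finset.mem_univ a), if_pos rfl, one_mul]
  push_cast
  refine Finset.prod_congr rfl fun i hi => ?_
  rw [if_neg (fun h => Finset.ne_of_mem_erase hi (Fin.ext h))]

/-- `i ∈ pt 6 j ↔` bit `i` of `j` is set. [this work] -/
theorem mem_pt_iff (i : Fin 6) (j : ℕ) : i ∈ pt 6 j ↔ j.testBit i = true := Iff.rfl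

/-- One factor of the product weight at `q ≡ 3/5`: `bw/5`. [this work] -/
theorem factor_eq (i : Fin 6) (j : ℕ) :
    (if i ∈ pt 6 j then ((q35 i : unitInterval) : ℝ) else 1 - ((q35 i : unitInterval) : ℝ)) = (bw j i : ℝ) / 5 := by
  rw [coe_q35]
  by_cases hb : j.testBit i = true
  · rw [if_pos ((mem_pt_iff i j).2 hb)]; simp only [bw, hb, if_true]; push_cast; norm_num
  · rw [if_neg (fun h => hb ((mem_pt_iff i j).1 h))]; simp only [bw, hb]; push_cast; norm_num

/-- The product weight at `q ≡ 3/5` of a coded point is `w(j)/5⁶`. [this work] -/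
theorem weight_q35 (j : ℕ) : bernoulliWeight q35 (pt 6 j) = (wt j : ℝ) / 15625 := by
  show (∏ i : Fin 6, if i ∈ pt 6 j then ((q35 i : unitInterval) : ℝ) else 1 - ((q35 i : unitInterval) : ℝ)) = _
  rw [Finset.prod_congr rfl fun i _ => factor_eq i j, Finset.prod_div_distrib, Finset.prod_const, Finset.card_univ,
    Fintype.card_fin, wt]
  push_cast
  norm_num

/-- The product weight of `q[a ↦ 1]`: `wtE(a,j)/5⁵` on the face `x_a = 1`, `0` off it. [this work] -/
theorem weight_top (a : Fin 6) (j : ℕ) :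
    bernoulliWeight (update q35 a 1) (pt 6 j) = if j.testBit a = true then (wtE a j : ℝ) / 3125 else 0 := by
  show (∏ i : Fin 6, if i ∈ pt 6 j then ((update q35 a 1 i : unitInterval) : ℝ)
      else 1 - ((update q35 a 1 i : unitInterval) : ℝ)) = _
  rw [← Finset.mul_prod_erase Finset.univ _ (Finset.mem_univ a)]
  have h : ∀ i ∈ Finset.univ.erase a, (if i ∈ pt 6 j then ((update q35 a 1 i : unitInterval) : ℝ)
      else 1 - ((update q35 a 1 i : unitInterval) : ℝ)) = (bw j i : ℝ) / 5 := by
    intro i hi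
    rw [update_of_ne (Finset.ne_of_mem_erase hi)]
    exact factor_eq i j
  rw [Finset.prod_congr rfl h, Finset.prod_div_distrib, Finset.prod_const, Finset.card_erase_of_mem (Finset.mem_univ _),
    Finset.card_univ, Fintype.card_fin, update_self, Set.Icc.coe_one, wtE_eq]
  by_cases hb : j.testBit a = true
  · rw [if_pos ((mem_pt_iff a j).2 hb), if_pos hb]; ring
  · rw [if_neg (fun h => hb ((mem_pt_iff a j).1 h)), if_neg hb]; ring

/-- The product weight of `q[a ↦ 0]`: `wtE(a,j)/5⁵` on the face `x_a = 0`, `0` off it. [this work] -/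
theorem weight_bot (a : Fin 6) (j : ℕ) :
    bernoulliWeight (update q35 a 0) (pt 6 j) = if j.testBit a = true then 0 else (wtE a j : ℝ) / 3125 := by
  show (∏ i : Fin 6, if i ∈ pt 6 j then ((update q35 a 0 i : unitInterval) : ℝ)
      else 1 - ((update q35 a 0 i : unitInterval) : ℝ)) = _
  rw [← Finset.mul_prod_erase Finset.univ _ (Finset.mem_univ a)]
  have h : ∀ i ∈ Finset.univ.erase a, (if i ∈ pt 6 j then ((update q35 a 0 i : unitInterval) : ℝ)
      else 1 - ((update q35 a 0 i : unitInterval) : ℝ)) = (bw j i : ℝ) / 5 := by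
    intro i hi
    rw [update_of_ne (Finset.ne_of_mem_erase hi)]
    exact factor_eq i j
  rw [Finset.prod_congr rfl h, Finset.prod_div_distrib, Finset.prod_const, Finset.card_erase_of_mem (Finset.mem_univ _),
    Finset.card_univ, Fintype.card_fin, update_self, Set.Icc.coe_zero, wtE_eq]
  by_cases hb : j.testBit a = true
  · rw [if_pos ((mem_pt_iff a j).2 hb), if_pos hb]; ring
  · rw [if_neg (fun h => hb ((mem_pt_iff a j).1 h)), if_neg hb]; ring

/-- Expectation at `q ≡ 3/5` as a weighted sum over the codes. [this work] -/
theorem ex_q35 (F : Set (Fin 6) → ℝ) :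
    ex (bernoulliWeight q35) F = (1 / 15625) * ∑ j ∈ Finset.range 64, (wt j : ℝ) * F (pt 6 j) := by
  rw [ex_def, SahiTransportJR.sum_eq_sum_range (m := 6) (fun x => bernoulliWeight q35 x * F x), Finset.mul_sum]
  refine Finset.sum_congr (by norm_num) fun j _ => ?_
  rw [weight_q35]; ring

/-- Expectation under `q[a ↦ 1]` as a weighted sum over the codes of the face `x_a = 1`. [this work] -/
theorem ex_top (a : Fin 6) (F : Set (Fin 6) → ℝ) :
    ex (bernoulliWeight (update q35 a 1)) F =
      (1 / 3125) * ∑ j ∈ Finset.range 64, (if j.testBit a = true then (wtE a j : ℝ) * F (pt 6 j) else 0) := by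
  rw [ex_def, SahiTransportJR.sum_eq_sum_range (m := 6) (fun x => bernoulliWeight (update q35 a 1) x * F x), Finset.mul_sum]
  refine Finset.sum_congr (by norm_num) fun j _ => ?_
  rw [weight_top]; split_ifs <;> ring

/-- Expectation under `q[a ↦ 0]` as a weighted sum over the codes of the face `x_a = 0`. [this work] -/
theorem ex_bot (a : Fin 6) (F : Set (Fin 6) → ℝ) :
    ex (bernoulliWeight (update q35 a 0)) F =
      (1 / 3125) * ∑ j ∈ Finset.range 64, (if j.testBit a = true then 0 else (wtE a j : ℝ) * F (pt 6 j)) := by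
  rw [ex_def, SahiTransportJR.sum_eq_sum_range (m := 6) (fun x => bernoulliWeight (update q35 a 0) x * F x), Finset.mul_sum]
  refine Finset.sum_congr (by norm_num) fun j _ => ?_
  rw [weight_bot]; split_ifs <;> ring

/-! ### 3. Membership of the coded points: Boolean predicates -/

/-- Bits of `A`. [this work] -/
def bA (j : ℕ) : Bool := (j.testBit 0 || j.testBit 1) && ((j.testBit 2 || j.testBit 3) || (j.testBit 4 || j.testBit 5))

/-- Bits of `B`. [this work] -/
def bB (j : ℕ) : Bool := ((j.testBit 0 || j.testBit 1) || (j.testBit 2 || j.testBit 3)) && (j.testBit 4 || j.testBit 5)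

/-- Bits of `C`. [this work] -/
def bC (j : ℕ) : Bool := (j.testBit 2 || j.testBit 3) && ((j.testBit 0 || j.testBit 1) || (j.testBit 4 || j.testBit 5))

/-- Membership of a coded point in `A`. [this work] -/
theorem mem_dsA (j : ℕ) : pt 6 j ∈ dsA ↔ bA j = true := by
  simp [dsA, pt, bA]

/-- Membership of a coded point in `B`. [this work] -/
theorem mem_dsB (j : ℕ) : pt 6 j ∈ dsB ↔ bB j = true := by
  simp [dsB, pt, bB]

/-- Membership of a coded point in `C`. [this work] -/
theorem mem_dsC (j : ℕ) : pt 6 j ∈ dsC ↔ bC j = true := by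
  simp [dsC, pt, bC]

/-! ### 4. The weighted Boolean sums as natural numbers, and the kernel computations -/

/-- Bulk sum `Σ_{j : c} w(j)`. [this work] -/
def SF (c : ℕ → Bool) : ℕ := ∑ j ∈ Finset.range 64, if c j = true then wt j else 0

/-- Face-`1` sum along axis `a`: `Σ_{j : bit a set, c} wtE(a,j)`. [this work] -/
def ST (a : ℕ) (c : ℕ → Bool) : ℕ := ∑ j ∈ Finset.range 64, if (j.testBit a && c j) = true then wtE a j else 0

/-- Face-`0` sum along axis `a`: `Σ_{j : bit a clear, c} wtE(a,j)`. [this work] -/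
def SB (a : ℕ) (c : ℕ → Bool) : ℕ := ∑ j ∈ Finset.range 64, if (!j.testBit a && c j) = true then wtE a j else 0

/-- `w·𝟙_c` summed in `ℝ` is the cast of `SF c`. [this work] -/
theorem sum_full_cast (c : ℕ → Bool) :
    (∑ j ∈ Finset.range 64, (wt j : ℝ) * (if c j = true then 1 else 0)) = (SF c : ℝ) := by
  rw [SF]; push_cast
  refine Finset.sum_congr rfl fun j _ => ?_
  split_ifs <;> simp

/-- Face-`1` version: the cast of `ST a c`. [this work] -/
theorem sum_top_cast (c : ℕ → Bool) (a : ℕ) :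
    (∑ j ∈ Finset.range 64, (if j.testBit a = true then (wtE a j : ℝ) * (if c j = true then 1 else 0) else 0)) =
      (ST a c : ℝ) := by
  rw [ST]; push_cast
  refine Finset.sum_congr rfl fun j _ => ?_
  cases hj : j.testBit a <;> cases hc : c j <;> simp

/-- Face-`0` version: the cast of `SB a c`. [this work] -/
theorem sum_bot_cast (c : ℕ → Bool) (a : ℕ) :
    (∑ j ∈ Finset.range 64, (if j.testBit a = true then 0 else (wtE a j : ℝ) * (if c j = true then 1 else 0))) =
      (SB a c : ℝ) := by
  rw [SB]; push_cast
  refine Finset.sum_congr rfl fun j _ => ?_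
  cases hj : j.testBit a <;> cases hc : c j <;> simp

/-- The seven bulk counts at `q ≡ 3/5` (kernel computation over `j < 64`): singles `12789`, pairs `11025`, triple `9261`. [this work] -/
theorem counts_full :
    SF bA = 12789 ∧ SF bB = 12789 ∧ SF bC = 12789 ∧ SF (fun j => bA j && bB j) = 11025 ∧ SF (fun j => bA j && bC j) = 11025 ∧
      SF (fun j => bB j && bC j) = 11025 ∧ SF (fun j => bA j && bB j && bC j) = 9261 := by
  decide

/-- **Kernel identity on the face `x_a = 1`, uniformly in the axis**: `2·5¹⁰·S_{ABC} + S_A S_B S_C = 5⁵(S_A S_{BC} + S_B S_{AC} + S_C S_{AB})`,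
i.e. `5¹⁵·Φ_a(1) = 0`, for all six `a` (singles `∈ {3045, 2625}`, pairs `∈ {2625, 2205}`, triple `2205`). [this work] -/
theorem top_identity : ∀ a : Fin 6,
    2 * 9765625 * ST a (fun j => bA j && bB j && bC j) + ST a bA * ST a bB * ST a bC =
      3125 * (ST a bA * ST a (fun j => bB j && bC j) + ST a bB * ST a (fun j => bA j && bC j) +
        ST a bC * ST a (fun j => bA j && bB j)) := by
  decide

/-- **Kernel identity on the face `x_a = 0`, uniformly in the axis**: `5¹⁵·Φ_a(0) = 93901248` for all six `a`
(singles `∈ {1827, 2457}`, pairs `∈ {1575, 2205}`, triple `1323`). [this work] -/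
theorem bot_identity : ∀ a : Fin 6,
    2 * 9765625 * SB a (fun j => bA j && bB j && bC j) + SB a bA * SB a bB * SB a bC =
      3125 * (SB a bA * SB a (fun j => bB j && bC j) + SB a bB * SB a (fun j => bA j && bC j) +
        SB a bC * SB a (fun j => bA j && bB j)) + 93901248 := by
  decide

/-! ### 5. The values of `E_3`: the bulk, and the two sections along every axis -/

/-- **`E_3(μ_{3/5}; A, B, C) = 4407346944/5¹⁸`.** [this work] -/
theorem sahiE_three_q35 : sahiE (bernoulliWeight q35) 3 ![ind dsA, ind dsB, ind dsC] = 4407346944 / 3814697265625 := by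
  rw [sahiE_three]
  simp only [ex_q35, Pi.mul_apply, ind_eq_ite _ _ _ (mem_dsA _), ind_eq_ite _ _ _ (mem_dsB _), ind_eq_ite _ _ _ (mem_dsC _),
    SahiCoordinateTwoThirdsFalse.ite_mul_ite, sum_full_cast]
  obtain ⟨h1, h2, h3, h4, h5, h6, h7⟩ := counts_full
  have e : (2 * 244140625 * (SF (fun j => bA j && bB j && bC j) : ℝ) + (SF bA : ℝ) * SF bB * SF bC -
      15625 * ((SF bA : ℝ) * SF (fun j => bB j && bC j) + (SF bB : ℝ) * SF (fun j => bA j && bC j) +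
        (SF bC : ℝ) * SF (fun j => bA j && bB j))) = 4407346944 := by
    rw [h1, h2, h3, h4, h5, h6, h7]; norm_num
  linear_combination e / 3814697265625

/-- **The `1`-sections have `E_3 = 0` along every axis** (`Φ_a(1) = 0`: one pair-letter becomes sure). [this work] -/
theorem sahiE_three_top (a : Fin 6) : sahiE (bernoulliWeight (update q35 a 1)) 3 ![ind dsA, ind dsB, ind dsC] = 0 := by
  rw [sahiE_three]
  simp only [ex_top, Pi.mul_apply, ind_eq_ite _ _ _ (mem_dsA _), ind_eq_ite _ _ _ (mem_dsB _), ind_eq_ite _ _ _ (mem_dsC _),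
    SahiCoordinateTwoThirdsFalse.ite_mul_ite, sum_top_cast]
  have h' : (2 * 9765625 * (ST a (fun j => bA j && bB j && bC j) : ℝ) + (ST a bA : ℝ) * ST a bB * ST a bC =
      3125 * ((ST a bA : ℝ) * ST a (fun j => bB j && bC j) + (ST a bB : ℝ) * ST a (fun j => bA j && bC j) +
        (ST a bC : ℝ) * ST a (fun j => bA j && bB j))) := by
    exact_mod_cast top_identity a
  linear_combination h' / 30517578125

/-- **The `0`-sections have `E_3 = 93901248/5¹⁵` along every axis** (`Φ_a(0)`). [this work] -/
theorem sahiE_three_bot (a : Fin 6) :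
    sahiE (bernoulliWeight (update q35 a 0)) 3 ![ind dsA, ind dsB, ind dsC] = 93901248 / 30517578125 := by
  rw [sahiE_three]
  simp only [ex_bot, Pi.mul_apply, ind_eq_ite _ _ _ (mem_dsA _), ind_eq_ite _ _ _ (mem_dsB _), ind_eq_ite _ _ _ (mem_dsC _),
    SahiCoordinateTwoThirdsFalse.ite_mul_ite, sum_bot_cast]
  have h' : (2 * 9765625 * (SB a (fun j => bA j && bB j && bC j) : ℝ) + (SB a bA : ℝ) * SB a bB * SB a bC =
      3125 * ((SB a bA : ℝ) * SB a (fun j => bB j && bC j) + (SB a bB : ℝ) * SB a (fun j => bA j && bC j) +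
        (SB a bC : ℝ) * SB a (fun j => bA j && bB j)) + 93901248) := by
    exact_mod_cast bot_identity a
  linear_combination h' / 30517578125

/-! ### 6. The fibre cubic at `1`, `0` and `q_a`, and the refutation -/

/-- Bridge to the tree's fibre cubic (whose `update` carries the classical `DecidableEq` instance):
`E_3(μ_{q[a ↦ s]}; A,B,C) = Φ_a(s)`. [this work] -/
theorem sahiE_three_update_eq' (a : Fin 6) (s : unitInterval) :
    sahiE (bernoulliWeight (update q35 a s)) 3 ![ind dsA, ind dsB, ind dsC] =
      cubicE3 q35 a (ind dsA) (ind dsB) (ind dsC) (s : ℝ) := by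
  convert sahiE_three_update_eq q35 a s (ind dsA) (ind dsB) (ind dsC)

/-- `Φ_a(1)`, `Φ_a(0)`, `Φ_a(q_a)` are `E_3` under `q[a ↦ 1]`, `q[a ↦ 0]`, `q`: `0`, `93901248/5¹⁵`, `4407346944/5¹⁸`.  (So the
least facet value `Φ_a(1) = 0` IS below `E_3(μ_q)`: the slice minimum principle of `…SahiSliceMinimum` holds here with room,
while the chord — an average of the two facets — does not.) [this work] -/
theorem cubicE3_values (a : Fin 6) :
    cubicE3 q35 a (ind dsA) (ind dsB) (ind dsC) 1 = 0 ∧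
      cubicE3 q35 a (ind dsA) (ind dsB) (ind dsC) 0 = 93901248 / 30517578125 ∧
      cubicE3 q35 a (ind dsA) (ind dsB) (ind dsC) (q35 a) = 4407346944 / 3814697265625 := by
  refine ⟨?_, ?_, ?_⟩
  · rw [← Set.Icc.coe_one, ← sahiE_three_update_eq' a 1, sahiE_three_top]
  · rw [← Set.Icc.coe_zero, ← sahiE_three_update_eq' a 0, sahiE_three_bot]
  · rw [← sahiE_three_update_eq' a (q35 a), update_eq_self, sahiE_three_q35]

/-- **Every axis of the doubled star at bias `3/5` has NEGATIVE sectional chord defect**: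
`q_aΦ_a(1) + (1 − q_a)Φ_a(0) = 4695062400/5¹⁸ > 4407346944/5¹⁸ = Φ_a(q_a)`. [this work] -/
theorem chord_gt (a : Fin 6) :
    cubicE3 q35 a (ind dsA) (ind dsB) (ind dsC) (q35 a) <
      (q35 a : ℝ) * cubicE3 q35 a (ind dsA) (ind dsB) (ind dsC) 1 +
        (1 - (q35 a : ℝ)) * cubicE3 q35 a (ind dsA) (ind dsB) (ind dsC) 0 := by
  obtain ⟨h1, h0, hq⟩ := cubicE3_values a
  rw [h1, h0, hq, coe_q35]
  norm_num

/-- **CONJECTURE GA (`SahiGoodAxis.GoodAxis`) IS FALSE.** Witness: the doubled star `(P(Q∨R), (P∨Q)R, Q(P∨R))` on `Fin 6`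
at `q ≡ 3/5` with `S` = all coordinates; no axis has nonnegative sectional defect. [this work] -/
theorem not_goodAxis : ¬ GoodAxis := by
  intro h
  obtain ⟨a, -, ha⟩ := h (Fin 6) q35 dsU isUpperSet_dsU Finset.univ Finset.univ_nonempty (fun i => determinedBy_univ' _)
  have e0 : dsU 0 = dsA := rfl
  have e1 : dsU 1 = dsB := rfl
  have e2 : dsU 2 = dsC := rfl
  rw [e0, e1, e2] at ha
  exact absurd ha (not_le.2 (chord_gt a))

end SahiGoodAxisFalse

end Summit.CriticalPhenomena.PercolationContinuityZ3.Theorems
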